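import Mathlib

/-!
# SoloInformed — the unit-norm law R8 behind the three-strand profiles (s28 close)

On a standard Kummer line `L = K(η^{1/7})` of the `p = 7` inert model (paper (16.13)(k), (j″)) the
free strand ends in degree `5` are counted by the `ω⁰`-part of `E_K / N_{L/K} E_L`, which is
`E_F ⊗ ℤ₇ / N_{F_η/F}(E_{F_η} ⊗ ℤ₇)` with `F_η = F(η^{1/7})`.  Law **R8**: this quotient is cyclic,
because the line unit `η ∈ E_F` is itself a norm — it is the norm of the unit `η^{1/7}` of `F_η`.
Hence at most one free end sits in degree `5`, and the shape `(n₃, n₅) = (3, 1)` (two degree-5 free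
ends) never occurs — as observed in `0` of `911` census lines.

This file is the kernel-checked algebraic core: for any field `F`, any `η : F` and any `n > 0`, the
norm from `F[X]/(Xⁿ − η)` down to `F` of the class of `X` is `(-1)^(n+1) · η`; for `n = 7` it is `η`.
No irreducibility hypothesis is needed (the statement is about the free rank-`n` algebra
`AdjoinRoot (X ^ n - C η)`); when `Xⁿ − η` is irreducible this algebra is the field `F(η^{1/n})`.
-/

namespace Summit.Langlands.Langlands.Theorems

open Polynomial

/-- R8, algebraic core: in `F[X]/(Xⁿ − η)` (`n > 0`) the norm of the root is `(-1)^(n+1) · η`. -/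
theorem soloInformed_norm_root_X_pow_sub_C {F : Type*} [Field F] (η : F) {n : ℕ} (hn : 0 < n) :
    Algebra.norm F (AdjoinRoot.root (X ^ n - C η : F[X])) = (-1) ^ (n + 1) * η := by
  have hmonic : (X ^ n - C η : F[X]).Monic := monic_X_pow_sub_C η (Nat.pos_iff_ne_zero.mp hn)
  have hf : (X ^ n - C η : F[X]) ≠ 0 := hmonic.ne_zero
  have h := Algebra.PowerBasis.norm_gen_eq_coeff_zero_minpoly (AdjoinRoot.powerBasis hf)
  rw [AdjoinRoot.minpoly_powerBasis_gen_of_monic hmonic hf, AdjoinRoot.powerBasis_gen,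
    AdjoinRoot.powerBasis_dim, natDegree_X_pow_sub_C] at h
  rw [h, coeff_sub, coeff_X_pow, coeff_C, if_neg (Nat.pos_iff_ne_zero.mp hn).symm, if_pos rfl]
  ring

/-- R8 for the septic Kummer lines of the `p = 7` model: the norm of `η^{1/7}` from `F[X]/(X⁷ − η)`
to `F` is `η` itself — so the line unit `η` is always a norm from the unit group of `F(η^{1/7})`. -/
theorem soloInformed_norm_seventh_root {F : Type*} [Field F] (η : F) :
    Algebra.norm F (AdjoinRoot.root (X ^ 7 - C η : F[X])) = η := by
  rw [soloInformed_norm_root_X_pow_sub_C η (by norm_num : 0 < 7)]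
  ring

/-- The counting half of R8: in a two-dimensional space over a field (here `E_F/E_F^7` over `𝔽₇`,
spanned by the classes of the two fundamental units), a subspace containing a nonzero vector
(the class of `η`, which lies in the image of the norm) has a quotient of dimension at most `1` —
at most one free strand end in degree `5`. -/
theorem soloInformed_quotient_rank_le_one {k V : Type*} [Field k] [AddCommGroup V] [Module k V]
    (h2 : Module.finrank k V = 2) (W : Submodule k V) {v : V} (hv : v ∈ W) (hv0 : v ≠ 0) :
    Module.finrank k (V ⧸ W) ≤ 1 := by
  have hfin : Module.Finite k V := Module.finite_of_finrank_eq_succ h2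
  have hW : 1 ≤ Module.finrank k W := by
    have : Module.finrank k (k ∙ v) = 1 := finrank_span_singleton hv0
    calc 1 = Module.finrank k (k ∙ v) := this.symm
      _ ≤ Module.finrank k W := Submodule.finrank_mono ((Submodule.span_singleton_le_iff_mem v W).mpr hv)
  have hsum := Submodule.finrank_quotient_add_finrank W
  omega

end Summit.Langlands.Langlands.Theorems
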